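import Literature.NumberTheory.LFunctions.SiegelZeroRealZeroIsolation
import Literature.NumberTheory.LFunctions.CentralValueNonnegativityClassNumberBound
import HarnessLib

/-!
# Small class number — in particular a Siegel zero of quality `η ≳ d^{1/4}` — makes `L(σ, χ)` NEGATIVE on the whole
# segment `[½, 1 − 1/log(√d/2)]`: all real zeros of the exceptional `L`-function in `[½, 1)` are confined to
# `(1 − 1/log(√d/2), 1)` (kernel)

Topic `Literature/NumberTheory/LFunctions` (namespace `Literature.NumberTheory.LFunctions`, sub-namespace
`RealPointExit`, continuing `RealPointNonnegativityClassNumberBound.lean` and `SiegelZeroRealZeroIsolation.lean`).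
Everything in this file is PROVED (theorems only; no definition, no named fact, debt 0). Cell `parity-realchar`
(SIEGEL INSTRUMENT, conditionals column (3)), Direction I: Deuring's phenomenon «small class number ⇒ the principal
form dominates» for the REAL ZEROS of the exceptional character, uniformly on the critical segment, explicit.

## The uniform bound and the statements

`χ` odd real primitive mod `d`, `K` quadratic with `d_K = −d`, `y = √d/2`, `L = log y ≥ 8`. The one-point bound
`B(σ) = 2y^σ(1/(2σ−1) − 1/(2σ)) − 2y^{1−σ}(1/(2−2σ) + 1/(2σ−1)) − 1` of `RealPointNonnegativityClassNumberBound.lean`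
is bounded below UNIFORMLY on `σ ∈ (½, ¾]` (`bracket_ge_uniform`): with `σ = ½ + u`, `t = uL`,
`B = 2√y[(e^t − e^{−t})/(2u) − e^t/(1+2u) − e^{−t}/(1−2u)] − 1`; for `t ≤ 1` use `e^t − e^{−t} ≥ 2t` (first term
`≥ L`), `e^t ≤ e`, `1/(1−2u) ≤ 2`; for `1 ≤ t ≤ L/4` use `1/(2u) = L/(2t)`, `L/(2t) − 1 ≥ L/(4t)`, `e^t ≥ et`,
`e^{−t} ≤ e^{−1}`. In both cases **`B(σ) ≥ √y(0.99L − 1.5) − 1`**, whence with `σ(1−σ) ≥ 3/16` on `(½, ¾]`: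

* `LFunction_neg_on_centralHalf_of_classNumber_lt` — **`h_K < 13/16 + (3/16)√y(0.99 log y − 1.5)` ⇒
  `Re L(σ, χ) < 0` for EVERY `σ ∈ [½, ¾]`** (the endpoint `½` by `CentralValueExit.LFunction_half_neg_of_classNumber_lt`);
* `LFunction_neg_on_window_of_classNumber_lt` — class-number form of the window theorem of
  `SiegelZeroRealZeroIsolation.lean`: `h_K < κ₂e^{−κ₂}y/(2L) − 2e^{κ₂} + ¾`, `1 ≤ κ₁ ≤ κ₂ ≤ L/4` ⇒ `Re L(β, χ) < 0`
  on `[1 − κ₂/L, 1 − κ₁/L]`;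
* `LFunction_neg_on_segment_of_classNumber_lt` — with `κ₂ = L/4`, `κ₁ = 1` (threshold `y^{3/4}/8 − 2y^{1/4} + ¾`):
  **both thresholds ⇒ `Re L(σ, χ) < 0` for EVERY `σ ∈ [½, 1 − 1/log y]`**;
* `realZeros_confined_of_classNumber_lt` — hence **every real zero `β ≥ ½` of `L(s, χ)` has `β > 1 − 1/log(√d/2)`,
  and a real zero in `(1 − 1/log(√d/2), 1)` EXISTS**;
* on the column's predicate (`IsSiegelZero χ η`, `η ≥ 40`, kernel I.1 ceiling `h_K ≤ √d log d/(πη)`):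
  `LFunction_neg_on_segment_of_isSiegelZero`, `realZeros_confined_of_isSiegelZero` — **a Siegel zero of quality `η`
  with `√d log d/(πη)` below both thresholds (`η ≳ 6·d^{1/4}`) makes the exceptional `L(s, χ)` NEGATIVE on all of
  `[½, 1 − 1/log(√d/2)]`: NO real zero there; every real zero `β ≥ ½` lies in `(1 − 1/log(√d/2), 1)`**.

LABEL (cell rule): conditionals I (real-zero confinement for the exceptional character under small `h` / a strong
Siegel zero), kernel, fact-free. WHAT THIS IS NOT: says nothing about complex zeros or other characters (not
Deuring–Heilbronn); thresholds are power-quality (`η ≳ d^{1/4}`), far above Tao–Teräväinen's `η ≥ 10`; nothing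
here bears on parity (H5).

## References (context)

* [IwaniecConversations2006] §4–§5; Deuring 1933 / Heilbronn 1934 as recalled in Montgomery–Vaughan §11.5 notes.
* [BatemanGrosswald1964] Theorems 1–3.
* [TaoTeravainen2021] Definition 1.4.
-/

noncomputable section

open Complex Filter Topology Set
open Literature.Barriers.Parity
open Literature.NumberTheory.QuadraticFields Literature.NumberTheory.QuadraticFields.Quadratic
open _root_.NumberField Module

namespace Literature.NumberTheory.LFunctions

namespace RealPointExit

/-! ### Elementary exponential inequalities -/

/-- `e^t − e^{−t} ≥ 2t` for `t ≥ 0` (`e^t ≥ 1 + t + t²/2` and `e^{−t} ≤ 1 − t + t²/2`). [folklore] -/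
private theorem two_mul_le_exp_sub_exp_neg {t : ℝ} (ht : 0 ≤ t) : 2 * t ≤ Real.exp t - Real.exp (-t) := by
  have h1 : 1 + t + t ^ 2 / 2 ≤ Real.exp t := Real.quadratic_le_exp_of_nonneg ht
  have h2 : Real.exp (-t) ≤ 1 - t + t ^ 2 / 2 := by
    have hpos : 0 < 1 + t + t ^ 2 / 2 := by positivity
    have hprod : 1 ≤ (1 - t + t ^ 2 / 2) * (1 + t + t ^ 2 / 2) := by nlinarith [sq_nonneg t, sq_nonneg (t ^ 2)]
    have he : Real.exp (-t) * (1 + t + t ^ 2 / 2) ≤ 1 := by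
      calc Real.exp (-t) * (1 + t + t ^ 2 / 2) ≤ Real.exp (-t) * Real.exp t :=
            mul_le_mul_of_nonneg_left h1 (Real.exp_pos _).le
        _ = 1 := by rw [← Real.exp_add]; simp
    by_contra hcon
    push Not at hcon
    have : (1 - t + t ^ 2 / 2) * (1 + t + t ^ 2 / 2) < Real.exp (-t) * (1 + t + t ^ 2 / 2) :=
      mul_lt_mul_of_pos_right hcon hpos
    linarith
  linarith

/-- `e·t ≤ e^t` for every real `t` (`e^{t−1} ≥ 1 + (t − 1) = t`). [folklore] -/
private theorem e_mul_le_exp (t : ℝ) : Real.exp 1 * t ≤ Real.exp t := by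
  have h1 : 1 + (t - 1) ≤ Real.exp (t - 1) := by
    have := Real.add_one_le_exp (t - 1); linarith
  have he0 : 0 < Real.exp 1 := Real.exp_pos 1
  calc Real.exp 1 * t = Real.exp 1 * (1 + (t - 1)) := by ring
    _ ≤ Real.exp 1 * Real.exp (t - 1) := mul_le_mul_of_nonneg_left h1 he0.le
    _ = Real.exp t := by rw [← Real.exp_add]; ring_nf

/-! ### The uniform lower bound on `(½, ¾]` -/

/-- **Uniform bound on the left half of the segment**: for `y > 1` with `L = log y ≥ 8` and `σ ∈ (½, ¾]`,
`2y^σ(1/(2σ−1) − 1/(2σ)) − 2y^{1−σ}(1/(2−2σ) + 1/(2σ−1)) − 1 ≥ √y(0.99 L − 1.5) − 1` — the Mellin-side constant term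
of Bateman–Grosswald's Theorem 1 bounded below uniformly (two regimes `t = (σ−½)L ≶ 1`).
[cite: BatemanGrosswald1964, Theorem 1 (3)–(5)] -/
theorem bracket_ge_uniform {y σ : ℝ} (hy1 : 1 < y) (hL : 8 ≤ Real.log y) (hσ : 1 / 2 < σ) (hσ1 : σ ≤ 3 / 4) :
    Real.sqrt y * (0.99 * Real.log y - 1.5) - 1 ≤
      2 * y ^ σ * (1 / (2 * σ - 1) - 1 / (2 * σ)) -
        2 * y ^ (1 - σ) * (1 / (2 - 2 * σ) + 1 / (2 * σ - 1)) - 1 := by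
  have hy0 : 0 < y := by linarith
  set L := Real.log y with hLdef
  have hL0 : 0 < L := by linarith
  set u : ℝ := σ - 1 / 2 with hu
  have hu0 : 0 < u := by rw [hu]; linarith
  have hu4 : u ≤ 1 / 4 := by rw [hu]; linarith
  set t : ℝ := u * L with htdef
  have ht0 : 0 < t := mul_pos hu0 hL0
  have htL : t ≤ L / 4 := by rw [htdef]; nlinarith
  -- the powers of `y`
  have hsq : Real.sqrt y = y ^ (1 / 2 : ℝ) := Real.sqrt_eq_rpow y
  have hyu : y ^ u = Real.exp t := by
    rw [Real.rpow_def_of_pos hy0, ← hLdef, htdef, mul_comm]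
  have hσu : σ = 1 / 2 + u := by rw [hu]; ring
  have hpow1 : y ^ σ = Real.sqrt y * Real.exp t := by
    rw [hσu, Real.rpow_add hy0, ← hsq, hyu]
  have hpow2 : y ^ (1 - σ) = Real.sqrt y * Real.exp (-t) := by
    rw [show 1 - σ = 1 / 2 + (-u) by rw [hu]; ring, Real.rpow_add hy0, ← hsq, Real.rpow_neg hy0.le, hyu,
      Real.exp_neg]
  have e1 : 2 * σ - 1 = 2 * u := by rw [hu]; ring
  have e2 : 2 - 2 * σ = 1 - 2 * u := by rw [hu]; ring
  have e3 : 2 * σ = 1 + 2 * u := by rw [hu]; ring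
  rw [hpow1, hpow2, e1, e2, e3]
  have hs0 : 0 < Real.sqrt y := Real.sqrt_pos.2 hy0
  have h2u : 0 < 2 * u := by linarith
  have h1m : 0 < 1 - 2 * u := by linarith
  have h1p : 0 < 1 + 2 * u := by linarith
  -- the key inequality for `E = e^t(1/(2u) − 1/(1+2u)) − e^{−t}(1/(1−2u) + 1/(2u))`
  have hE : 0.495 * L - 0.75 ≤
      Real.exp t * (1 / (2 * u) - 1 / (1 + 2 * u)) - Real.exp (-t) * (1 / (1 - 2 * u) + 1 / (2 * u)) := by
    have het := Real.exp_pos t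
    have hent := Real.exp_pos (-t)
    rcases le_or_gt t 1 with ht1 | ht1
    · -- `t ≤ 1`: `(e^t − e^{−t})/(2u) ≥ L`, `e^t/(1+2u) ≤ e`, `e^{−t}/(1−2u) ≤ 2`
      have hA : L ≤ (Real.exp t - Real.exp (-t)) / (2 * u) := by
        rw [le_div_iff₀ h2u]
        have h := two_mul_le_exp_sub_exp_neg ht0.le
        have : L * (2 * u) = 2 * t := by rw [htdef]; ring
        linarith
      have hB : Real.exp t / (1 + 2 * u) ≤ Real.exp 1 := by
        rw [div_le_iff₀ h1p]
        have : Real.exp t ≤ Real.exp 1 := Real.exp_le_exp.2 ht1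
        nlinarith [Real.exp_pos (1 : ℝ)]
      have hC : Real.exp (-t) / (1 - 2 * u) ≤ 2 := by
        rw [div_le_iff₀ h1m]
        have : Real.exp (-t) ≤ 1 := by rw [Real.exp_le_one_iff]; linarith
        nlinarith
      have he := Real.exp_one_lt_d9
      have hEq : Real.exp t * (1 / (2 * u) - 1 / (1 + 2 * u)) - Real.exp (-t) * (1 / (1 - 2 * u) + 1 / (2 * u)) =
          (Real.exp t - Real.exp (-t)) / (2 * u) - Real.exp t / (1 + 2 * u) - Real.exp (-t) / (1 - 2 * u) := by
        ring
      rw [hEq]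
      linarith
    · -- `t ≥ 1`: `1/(2u) = L/(2t)`, `L/(2t) ≥ 2`
      have hu' : 1 / (2 * u) = L / (2 * t) := by
        rw [htdef]; field_simp
      rw [hu']
      have h1 : 1 / (1 + 2 * u) ≤ 1 := by rw [div_le_one h1p]; linarith
      have h2 : 1 / (1 - 2 * u) ≤ 2 := by rw [div_le_iff₀ h1m]; linarith
      have hL2t : 2 ≤ L / (2 * t) := by rw [le_div_iff₀ (by positivity)]; linarith
      have hL2t' : L / (2 * t) ≤ L / 2 :=
        div_le_div_of_nonneg_left hL0.le (by norm_num) (by linarith)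
      have hq : L / (4 * t) ≤ L / (2 * t) - 1 := by
        have : L / (4 * t) = L / (2 * t) / 2 := by field_simp; ring
        rw [this]; linarith
      have hfirst : Real.exp 1 * L / 4 ≤ Real.exp t * (L / (2 * t) - 1 / (1 + 2 * u)) := by
        calc Real.exp 1 * L / 4 = Real.exp 1 * t * (L / (4 * t)) := by field_simp
          _ ≤ Real.exp t * (L / (4 * t)) := mul_le_mul_of_nonneg_right (e_mul_le_exp t) (by positivity)
          _ ≤ Real.exp t * (L / (2 * t) - 1 / (1 + 2 * u)) :=
              mul_le_mul_of_nonneg_left (by linarith) het.le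
      have hsecond : Real.exp (-t) * (L / (2 * t) + 1 / (1 - 2 * u)) ≤ Real.exp (-1) * (L / 2 + 2) :=
        mul_le_mul (Real.exp_le_exp.2 (by linarith)) (by linarith) (by positivity) (Real.exp_pos _).le
      -- numerics: `e ≥ 2.7182818283`, `e^{−1} < 0.3678795`
      have he := Real.exp_one_gt_d9
      have hinv : Real.exp (-1) < 0.3678795 := by
        rw [Real.exp_neg, inv_lt_comm₀ (Real.exp_pos 1) (by norm_num)]
        refine lt_trans ?_ he
        norm_num
      nlinarith [Real.exp_pos (-1 : ℝ)]
  -- assemble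
  have := mul_le_mul_of_nonneg_left hE hs0.le
  nlinarith [Real.exp_pos t, Real.exp_pos (-t)]

variable {K : Type*} [Field K] [NumberField K]

/-- An odd character is non-trivial. [folklore] -/
private theorem ne_one_of_odd' {d : ℕ} [NeZero d] {χ : DirichletCharacter ℂ d} (hodd : χ.Odd) : χ ≠ 1 := by
  intro h
  have h1 : χ (-1) = -1 := hodd
  rw [h, MulChar.one_apply (isUnit_one.neg)] at h1
  norm_num at h1

/-- From `√d/2 ≥ e⁸`: `√d/2 > 1` and `d > 4`. [folklore] -/
private theorem basic_of_exp_eight_le {d : ℕ} (hy8 : Real.exp 8 ≤ Real.sqrt d / 2) :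
    1 < Real.sqrt d / 2 ∧ 4 < d ∧ 8 ≤ Real.log (Real.sqrt d / 2) := by
  have he8 : (1 : ℝ) < Real.exp 8 := by have := Real.add_one_le_exp (8 : ℝ); linarith
  have hy1 : 1 < Real.sqrt d / 2 := lt_of_lt_of_le he8 hy8
  refine ⟨hy1, ?_, ?_⟩
  · by_contra hcon
    push Not at hcon
    have : Real.sqrt d ≤ Real.sqrt 4 := Real.sqrt_le_sqrt (by exact_mod_cast hcon)
    have h4 : Real.sqrt 4 = 2 := by
      rw [show (4 : ℝ) = 2 ^ 2 by norm_num, Real.sqrt_sq (by norm_num)]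
    linarith
  · rw [Real.le_log_iff_exp_le (by linarith)]; exact hy8

/-! ### Negativity on `[½, ¾]` -/

/-- **`h_K < 13/16 + (3/16)√y(0.99 log y − 1.5)` (`y = √d/2 ≥ e⁸`) ⇒ `Re L(σ, χ) < 0` for EVERY `σ ∈ [½, ¾]`**
(`χ` odd real primitive mod `d`, `K` quadratic with `d_K = −d`): on `(½, ¾]` the one-point bound is at least
`1 + (3/16)(√y(0.99L − 1.5) − 1)` (`bracket_ge_uniform`, `σ(1−σ) ≥ 3/16`), at `½` the central-value threshold
`1 + ½√y(log y − 2)` is larger. [cite: IwaniecConversations2006, §4 (4.23)–(4.25) and §5] -/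
theorem LFunction_neg_on_centralHalf_of_classNumber_lt (h2 : finrank ℚ K = 2) {d : ℕ} [NeZero d]
    (hdK : NumberField.discr K = -(d : ℤ)) (hy8 : Real.exp 8 ≤ Real.sqrt d / 2) {χ : DirichletCharacter ℂ d}
    (hprim : χ.IsPrimitive) (hquad : χ.IsQuadratic) (hodd : χ.Odd)
    (hh : (classNumber K : ℝ) <
      13 / 16 + 3 / 16 * (Real.sqrt (Real.sqrt d / 2) * (0.99 * Real.log (Real.sqrt d / 2) - 1.5)))
    {σ : ℝ} (hσ : 1 / 2 ≤ σ) (hσ1 : σ ≤ 3 / 4) : (χ.LFunction (σ : ℂ)).re < 0 := by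
  obtain ⟨hy1, hd4, hL8⟩ := basic_of_exp_eight_le hy8
  set y := Real.sqrt d / 2 with hydef
  set L := Real.log y with hLdef
  have hy0 : 0 < y := by linarith
  have hsy : 0 < Real.sqrt y := Real.sqrt_pos.2 hy0
  rcases eq_or_lt_of_le hσ with h | h
  · -- `σ = ½`: the central-value threshold is larger
    have hhalf : ((1 / 2 : ℝ) : ℂ) = 1 / 2 := by push_cast; rfl
    rw [← h, hhalf]
    refine CentralValueExit.LFunction_half_neg_of_classNumber_lt h2 hdK hd4 hprim hquad hodd (lt_of_lt_of_le hh ?_)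
    -- `13/16 + (3/16)√y(0.99L − 1.5) ≤ 1 + ½√y(log y − 2) = 1 + d^{1/4}(…)/(4√2)`
    -- compare with the central-value threshold `1 + √y (log y − 2)/2`
    have hform : Real.sqrt (Real.sqrt d / 2) * (Real.log (Real.sqrt d / 2) - 2) / 2 =
        (d : ℝ) ^ (1 / 4 : ℝ) * (Real.log d - 2 * Real.log 2 - 4) / (4 * Real.sqrt 2) := by
      have hd0 : (0 : ℝ) < d := by exact_mod_cast (show 0 < d by omega)
      have hsd0 : 0 < Real.sqrt d := Real.sqrt_pos.2 hd0
      have hs2 : 0 < Real.sqrt 2 := Real.sqrt_pos.2 two_pos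
      have h1 : Real.sqrt (Real.sqrt d / 2) = (d : ℝ) ^ (1 / 4 : ℝ) / Real.sqrt 2 := by
        rw [Real.sqrt_div' _ (by norm_num : (0 : ℝ) ≤ 2), Real.sqrt_eq_rpow, Real.sqrt_eq_rpow,
          ← Real.rpow_mul hd0.le]
        norm_num
      have h2' : Real.log (Real.sqrt d / 2) = Real.log d / 2 - Real.log 2 := by
        rw [Real.log_div hsd0.ne' two_ne_zero, Real.log_sqrt hd0.le]
      rw [h1, h2']
      field_simp
      ring
    rw [← hform, ← hydef, ← hLdef]
    nlinarith
  · -- `σ ∈ (½, ¾]`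
    have hB := bracket_ge_uniform hy1 hL8 h hσ1
    rw [← hLdef] at hB
    have hσσ : 3 / 16 ≤ σ * (1 - σ) := by nlinarith
    refine (exists_realZero_of_classNumber_lt h2 hdK hd4 hprim hquad hodd h (by linarith) ?_).1
    rw [← hydef]
    -- `hh < 13/16 + (3/16)√y(0.99L−1.5) ≤ 1 + σ(1−σ)·B(σ)`
    have hBnn : 0 ≤ Real.sqrt y * (0.99 * L - 1.5) - 1 := by
      have : 1 ≤ Real.sqrt y := by
        rw [show (1 : ℝ) = Real.sqrt 1 by simp]
        exact Real.sqrt_le_sqrt hy1.le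
      nlinarith
    have hstep : 3 / 16 * (Real.sqrt y * (0.99 * L - 1.5) - 1) ≤
        σ * (1 - σ) * (2 * y ^ σ * (1 / (2 * σ - 1) - 1 / (2 * σ)) -
          2 * y ^ (1 - σ) * (1 / (2 - 2 * σ) + 1 / (2 * σ - 1)) - 1) :=
      calc 3 / 16 * (Real.sqrt y * (0.99 * L - 1.5) - 1)
          ≤ σ * (1 - σ) * (Real.sqrt y * (0.99 * L - 1.5) - 1) := mul_le_mul_of_nonneg_right hσσ hBnn
        _ ≤ _ := mul_le_mul_of_nonneg_left hB (by nlinarith)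
    linarith

/-! ### Negativity on a window `[1 − κ₂/L, 1 − κ₁/L]` from a class-number bound -/

/-- `κe^{−κ}` is antitone on `[1, ∞)`: `b e^{−b} ≤ a e^{−a}` for `1 ≤ a ≤ b`. [folklore] -/
private theorem mul_exp_neg_antitone' {a b : ℝ} (ha : 1 ≤ a) (hab : a ≤ b) :
    b * Real.exp (-b) ≤ a * Real.exp (-a) := by
  have h1 : 1 + (b - a) ≤ Real.exp (b - a) := by
    have := Real.add_one_le_exp (b - a); linarith
  have h2 : b ≤ a * (1 + (b - a)) := by nlinarith
  have heb : 0 < Real.exp (-b) := Real.exp_pos _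
  have h3 : b * Real.exp (-b) ≤ a * (1 + (b - a)) * Real.exp (-b) :=
    mul_le_mul_of_nonneg_right h2 heb.le
  have h4 : a * (1 + (b - a)) * Real.exp (-b) ≤ a * Real.exp (b - a) * Real.exp (-b) := by
    apply mul_le_mul_of_nonneg_right _ heb.le
    exact mul_le_mul_of_nonneg_left h1 (by linarith)
  have h5 : a * Real.exp (b - a) * Real.exp (-b) = a * Real.exp (-a) := by
    rw [mul_assoc, ← Real.exp_add]; ring_nf
  linarith

/-- **Window negativity from a class-number bound**: if `1 ≤ κ₁ ≤ κ₂ ≤ ¼ log(√d/2)` and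
`h_K < κ₂e^{−κ₂}(√d/2)/(2 log(√d/2)) − 2e^{κ₂} + ¾`, then `Re L(β, χ) < 0` for every
`β ∈ [1 − κ₂/log(√d/2), 1 − κ₁/log(√d/2)]` (the `κ`-bound is smallest at `κ₂` on `[κ₁, κ₂]`).
[cite: IwaniecConversations2006, §5] -/
theorem LFunction_neg_on_window_of_classNumber_lt (h2 : finrank ℚ K = 2) {d : ℕ} [NeZero d]
    (hdK : NumberField.discr K = -(d : ℤ)) {χ : DirichletCharacter ℂ d}
    (hprim : χ.IsPrimitive) (hquad : χ.IsQuadratic) (hodd : χ.Odd)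
    {κ₁ κ₂ : ℝ} (hκ₁ : 1 ≤ κ₁) (hκ₁₂ : κ₁ ≤ κ₂) (hL : 4 * κ₂ ≤ Real.log (Real.sqrt d / 2))
    (hh : (classNumber K : ℝ) <
      κ₂ * Real.exp (-κ₂) * (Real.sqrt d / 2) / (2 * Real.log (Real.sqrt d / 2)) - 2 * Real.exp κ₂ + 3 / 4)
    {β : ℝ} (hβ1 : 1 - κ₂ / Real.log (Real.sqrt d / 2) ≤ β) (hβ2 : β ≤ 1 - κ₁ / Real.log (Real.sqrt d / 2)) :
    (χ.LFunction (β : ℂ)).re < 0 := by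
  have hκ₂0 : 0 < κ₂ := by linarith
  have hlog : 0 < Real.log (Real.sqrt d / 2) := by linarith
  have hy1 : 1 < Real.sqrt d / 2 := by
    by_contra hcon
    push Not at hcon
    have := Real.log_nonpos (by positivity) hcon
    linarith
  set y := Real.sqrt d / 2 with hydef
  set L := Real.log y with hLdef
  have hL0 : 0 < L := hlog
  set κ : ℝ := (1 - β) * L with hκdef
  have hκ1 : κ₁ ≤ κ := by
    have : κ₁ / L ≤ 1 - β := by linarith
    have := mul_le_mul_of_nonneg_right this hL0.le
    rwa [div_mul_cancel₀ _ hL0.ne'] at this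
  have hκ2 : κ ≤ κ₂ := by
    have : 1 - β ≤ κ₂ / L := by linarith
    have := mul_le_mul_of_nonneg_right this hL0.le
    rwa [div_mul_cancel₀ _ hL0.ne'] at this
  have hκ0 : 0 < κ := by linarith
  have hβ : β = 1 - κ / L := by rw [hκdef]; field_simp; ring
  have hLκ : 4 * κ ≤ L := by linarith
  have hmono : κ₂ * Real.exp (-κ₂) * y / (2 * L) - 2 * Real.exp κ₂ + 3 / 4 ≤
      κ * Real.exp (-κ) * y / (2 * L) - 2 * Real.exp κ + 3 / 4 := by
    have h1 := mul_exp_neg_antitone' (le_trans hκ₁ hκ1) hκ2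
    have h2' : Real.exp κ ≤ Real.exp κ₂ := Real.exp_le_exp.2 hκ2
    have hy0 : 0 < y := by linarith
    have h3 : κ₂ * Real.exp (-κ₂) * y / (2 * L) ≤ κ * Real.exp (-κ) * y / (2 * L) := by
      rw [mul_div_assoc, mul_div_assoc]
      exact mul_le_mul_of_nonneg_right h1 (by positivity)
    linarith
  have h := (exists_realZero_of_classNumber_lt_at h2 hdK hprim hquad hodd hκ0 hLκ (lt_of_lt_of_le hh hmono)).1
  rw [← hβ] at h
  exact h

/-! ### Negativity on the whole segment `[½, 1 − 1/log y]` and confinement of the real zeros -/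

/-- **Negativity on `[½, 1 − 1/log(√d/2)]`.** If `y = √d/2 ≥ e⁸`,
`h_K < 13/16 + (3/16)√y(0.99 log y − 1.5)` and `h_K < y^{3/4}/8 − 2y^{1/4} + ¾`, then **`Re L(σ, χ) < 0` for every
`σ ∈ [½, 1 − 1/log y]`** (`[½, ¾]` by the uniform bound; `[¾, 1 − 1/L]` = the window `κ ∈ [1, L/4]`, whose
threshold is the `κ = L/4` value `y^{3/4}/8 − 2y^{1/4} + ¾` since `e^{L/4} = y^{1/4}`).
[cite: IwaniecConversations2006, §4 (4.23)–(4.25) and §5] -/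
theorem LFunction_neg_on_segment_of_classNumber_lt (h2 : finrank ℚ K = 2) {d : ℕ} [NeZero d]
    (hdK : NumberField.discr K = -(d : ℤ)) (hy8 : Real.exp 8 ≤ Real.sqrt d / 2) {χ : DirichletCharacter ℂ d}
    (hprim : χ.IsPrimitive) (hquad : χ.IsQuadratic) (hodd : χ.Odd)
    (hh : (classNumber K : ℝ) <
      13 / 16 + 3 / 16 * (Real.sqrt (Real.sqrt d / 2) * (0.99 * Real.log (Real.sqrt d / 2) - 1.5)))
    (hh' : (classNumber K : ℝ) <
      (Real.sqrt d / 2) ^ (3 / 4 : ℝ) / 8 - 2 * (Real.sqrt d / 2) ^ (1 / 4 : ℝ) + 3 / 4)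
    {σ : ℝ} (hσ : 1 / 2 ≤ σ) (hσ1 : σ ≤ 1 - 1 / Real.log (Real.sqrt d / 2)) : (χ.LFunction (σ : ℂ)).re < 0 := by
  obtain ⟨hy1, hd4, hL8⟩ := basic_of_exp_eight_le hy8
  set y := Real.sqrt d / 2 with hydef
  set L := Real.log y with hLdef
  have hy0 : 0 < y := by linarith
  have hL0 : 0 < L := by linarith
  rcases le_or_gt σ (3 / 4) with h34 | h34
  · exact LFunction_neg_on_centralHalf_of_classNumber_lt h2 hdK hy8 hprim hquad hodd hh hσ h34
  · -- the window `κ₁ = 1`, `κ₂ = L/4`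
    have hκ : 4 * (L / 4) ≤ Real.log (Real.sqrt d / 2) := by rw [← hydef, ← hLdef]; linarith
    refine LFunction_neg_on_window_of_classNumber_lt h2 hdK hprim hquad hodd (κ₁ := 1) (κ₂ := L / 4) le_rfl
      (by linarith) hκ ?_ ?_ ?_
    · -- the threshold at `κ₂ = L/4`: `(L/4)e^{−L/4} y/(2L) = y^{3/4}/8`, `e^{L/4} = y^{1/4}`
      rw [← hydef, ← hLdef]
      have hexp1 : Real.exp (L / 4) = y ^ (1 / 4 : ℝ) := by
        rw [Real.rpow_def_of_pos hy0, ← hLdef]; congr 1; ring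
      have hexp2 : Real.exp (-(L / 4)) * y = y ^ (3 / 4 : ℝ) := by
        have : y ^ (3 / 4 : ℝ) = y ^ (-(1 / 4) : ℝ) * y ^ (1 : ℝ) := by
          rw [← Real.rpow_add hy0]; norm_num
        rw [this, Real.rpow_one, Real.rpow_def_of_pos hy0, ← hLdef]
        congr 1; congr 1; ring
      have e : L / 4 * Real.exp (-(L / 4)) * y / (2 * L) - 2 * Real.exp (L / 4) + 3 / 4 =
          y ^ (3 / 4 : ℝ) / 8 - 2 * y ^ (1 / 4 : ℝ) + 3 / 4 := by
        rw [hexp1, mul_assoc (L / 4), hexp2]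
        field_simp
        ring
      rw [e]
      exact hh'
    · rw [← hydef, ← hLdef]
      have : L / 4 / L = 1 / 4 := by field_simp
      rw [this]; linarith
    · rw [← hydef, ← hLdef]; exact hσ1

/-- **Confinement of the real zeros.** Under the hypotheses of `LFunction_neg_on_segment_of_classNumber_lt`:
every real `β` with `½ ≤ β` and `L(β, χ) = 0` satisfies **`1 − 1/log(√d/2) < β < 1`**, and such a zero exists
(`L(1 − 1/log(√d/2), χ) < 0 < L(1, χ)`, intermediate value theorem). [cite: IwaniecConversations2006, §5]
[cite: MontgomeryVaughan2007, §11.2 Theorem 11.4] -/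
theorem realZeros_confined_of_classNumber_lt (h2 : finrank ℚ K = 2) {d : ℕ} [NeZero d]
    (hdK : NumberField.discr K = -(d : ℤ)) (hy8 : Real.exp 8 ≤ Real.sqrt d / 2) {χ : DirichletCharacter ℂ d}
    (hprim : χ.IsPrimitive) (hquad : χ.IsQuadratic) (hodd : χ.Odd)
    (hh : (classNumber K : ℝ) <
      13 / 16 + 3 / 16 * (Real.sqrt (Real.sqrt d / 2) * (0.99 * Real.log (Real.sqrt d / 2) - 1.5)))
    (hh' : (classNumber K : ℝ) <
      (Real.sqrt d / 2) ^ (3 / 4 : ℝ) / 8 - 2 * (Real.sqrt d / 2) ^ (1 / 4 : ℝ) + 3 / 4) :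
    (∀ β : ℝ, 1 / 2 ≤ β → χ.LFunction (β : ℂ) = 0 → 1 - 1 / Real.log (Real.sqrt d / 2) < β ∧ β < 1) ∧
      ∃ β : ℝ, 1 - 1 / Real.log (Real.sqrt d / 2) < β ∧ β < 1 ∧ χ.LFunction β = 0 := by
  obtain ⟨hy1, hd4, hL8⟩ := basic_of_exp_eight_le hy8
  have hχ1 := ne_one_of_odd' hodd
  refine ⟨fun β hβ h0 => ⟨?_, ?_⟩, ?_⟩
  · by_contra hcon
    push Not at hcon
    have h := LFunction_neg_on_segment_of_classNumber_lt h2 hdK hy8 hprim hquad hodd hh hh' hβ hcon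
    rw [h0, Complex.zero_re] at h
    exact lt_irrefl _ h
  · by_contra hcon
    push Not at hcon
    rcases eq_or_lt_of_le hcon with h | h
    · exact χ.LFunction_apply_one_ne_zero hχ1 (by rw [← h] at h0; exact_mod_cast h0)
    · exact DirichletCharacter.LFunction_ne_zero_of_one_le_re χ (Or.inl hχ1) (by simp; exact h.le) h0
  · -- existence via the `κ = 1` point theorem (threshold `y/(2eL) − 2e + ¾ ≥` the uniform one)
    set y := Real.sqrt d / 2 with hydef
    set L := Real.log y with hLdef
    have hy0 : 0 < y := by linarith
    have hL0 : 0 < L := by linarith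
    have hκ : 4 * (1 : ℝ) ≤ Real.log (Real.sqrt d / 2) := by rw [← hydef, ← hLdef]; linarith
    have h := exists_realZero_of_classNumber_lt_at h2 hdK hprim hquad hodd one_pos hκ ?_
    · simpa using h.2
    · -- `hh' < y^{3/4}/8 − 2y^{1/4} + ¾ ≤ 1·e^{−1}·y/(2L) − 2e + ¾`: use the window monotonicity at κ = 1 ≤ L/4
      rw [← hydef, ← hLdef]
      have hmono : (L / 4) * Real.exp (-(L / 4)) * y / (2 * L) - 2 * Real.exp (L / 4) + 3 / 4 ≤
          1 * Real.exp (-1) * y / (2 * L) - 2 * Real.exp 1 + 3 / 4 := by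
        have h1 := mul_exp_neg_antitone' le_rfl (by linarith : (1 : ℝ) ≤ L / 4)
        have h2' : Real.exp 1 ≤ Real.exp (L / 4) := Real.exp_le_exp.2 (by linarith)
        have h3 : L / 4 * Real.exp (-(L / 4)) * y / (2 * L) ≤ 1 * Real.exp (-1) * y / (2 * L) := by
          rw [mul_div_assoc, mul_div_assoc]
          exact mul_le_mul_of_nonneg_right h1 (by positivity)
        linarith
      have hexp1 : Real.exp (L / 4) = y ^ (1 / 4 : ℝ) := by
        rw [Real.rpow_def_of_pos hy0, ← hLdef]; congr 1; ring
      have hexp2 : Real.exp (-(L / 4)) * y = y ^ (3 / 4 : ℝ) := by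
        have : y ^ (3 / 4 : ℝ) = y ^ (-(1 / 4) : ℝ) * y ^ (1 : ℝ) := by
          rw [← Real.rpow_add hy0]; norm_num
        rw [this, Real.rpow_one, Real.rpow_def_of_pos hy0, ← hLdef]
        congr 1; congr 1; ring
      have e : L / 4 * Real.exp (-(L / 4)) * y / (2 * L) - 2 * Real.exp (L / 4) + 3 / 4 =
          y ^ (3 / 4 : ℝ) / 8 - 2 * y ^ (1 / 4 : ℝ) + 3 / 4 := by
        rw [hexp1, mul_assoc (L / 4), hexp2]
        field_simp
        ring
      rw [e] at hmono
      linarith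

/-! ### Under a Siegel zero -/

/-- **A strong Siegel zero makes the exceptional `L`-function negative on `[½, 1 − 1/log(√d/2)]`.** If the odd `χ`
mod `d` (`√d/2 ≥ e⁸`, `d ≥ 10⁴`) carries `IsSiegelZero χ η` with `η ≥ 40` and the kernel class-number ceiling
`√d log d/(πη)` lies below both thresholds `13/16 + (3/16)√y(0.99 log y − 1.5)` and `y^{3/4}/8 − 2y^{1/4} + ¾`
(`y = √d/2`; so `η ≳ 6 d^{1/4}`), then `Re L(σ, χ) < 0` for every `σ ∈ [½, 1 − 1/log y]`.
[cite: TaoTeravainen2021, Definition 1.4] [cite: IwaniecConversations2006, §5] -/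
theorem LFunction_neg_on_segment_of_isSiegelZero {d : ℕ} [NeZero d] (hd : 10 ^ 4 ≤ d)
    (hy8 : Real.exp 8 ≤ Real.sqrt d / 2) {χ : DirichletCharacter ℂ d} {η : ℝ} (hS : IsSiegelZero χ η)
    (hodd : χ.Odd) (h40 : 40 ≤ η)
    (hη : Real.sqrt d * Real.log d / (Real.pi * η) <
      13 / 16 + 3 / 16 * (Real.sqrt (Real.sqrt d / 2) * (0.99 * Real.log (Real.sqrt d / 2) - 1.5)))
    (hη' : Real.sqrt d * Real.log d / (Real.pi * η) <
      (Real.sqrt d / 2) ^ (3 / 4 : ℝ) / 8 - 2 * (Real.sqrt d / 2) ^ (1 / 4 : ℝ) + 3 / 4)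
    {σ : ℝ} (hσ : 1 / 2 ≤ σ) (hσ1 : σ ≤ 1 - 1 / Real.log (Real.sqrt d / 2)) : (χ.LFunction (σ : ℂ)).re < 0 := by
  have hprim := hS.1
  have hquad := hS.2.1
  obtain ⟨K, _i1, _i2, h2, hdK⟩ := exists_quadraticField_of_odd_primitive hprim hquad hodd
  have hup := SiegelZeroClassNumber.classNumber_le_of_isSiegelZero_odd_of_forty_le h2 hdK hd hS hodd h40
  have hup' : (classNumber K : ℝ) ≤ Real.sqrt d * Real.log d / (Real.pi * η) := by
    rw [show Real.sqrt d * Real.log d / (Real.pi * η) = 1 / Real.pi * Real.sqrt d * Real.log d / η by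
      field_simp]
    exact hup
  exact LFunction_neg_on_segment_of_classNumber_lt h2 hdK hy8 hprim hquad hodd (lt_of_le_of_lt hup' hη)
    (lt_of_le_of_lt hup' hη') hσ hσ1

/-- **Real zeros of the exceptional `L`-function crowd near `1`.** Under the hypotheses of
`LFunction_neg_on_segment_of_isSiegelZero`: every real zero `β ≥ ½` of `L(s, χ)` lies in
`(1 − 1/log(√d/2), 1)` (in particular the Siegel zero `1 − 1/(η log d)` has no companion in `[½, 1 − 1/log(√d/2)]`),
and a real zero in that interval exists. [cite: TaoTeravainen2021, Definition 1.4] [cite: IwaniecConversations2006, §5] -/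
theorem realZeros_confined_of_isSiegelZero {d : ℕ} [NeZero d] (hd : 10 ^ 4 ≤ d)
    (hy8 : Real.exp 8 ≤ Real.sqrt d / 2) {χ : DirichletCharacter ℂ d} {η : ℝ} (hS : IsSiegelZero χ η)
    (hodd : χ.Odd) (h40 : 40 ≤ η)
    (hη : Real.sqrt d * Real.log d / (Real.pi * η) <
      13 / 16 + 3 / 16 * (Real.sqrt (Real.sqrt d / 2) * (0.99 * Real.log (Real.sqrt d / 2) - 1.5)))
    (hη' : Real.sqrt d * Real.log d / (Real.pi * η) <
      (Real.sqrt d / 2) ^ (3 / 4 : ℝ) / 8 - 2 * (Real.sqrt d / 2) ^ (1 / 4 : ℝ) + 3 / 4) :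
    (∀ β : ℝ, 1 / 2 ≤ β → χ.LFunction (β : ℂ) = 0 → 1 - 1 / Real.log (Real.sqrt d / 2) < β ∧ β < 1) ∧
      ∃ β : ℝ, 1 - 1 / Real.log (Real.sqrt d / 2) < β ∧ β < 1 ∧ χ.LFunction β = 0 := by
  have hprim := hS.1
  have hquad := hS.2.1
  obtain ⟨K, _i1, _i2, h2, hdK⟩ := exists_quadraticField_of_odd_primitive hprim hquad hodd
  have hup := SiegelZeroClassNumber.classNumber_le_of_isSiegelZero_odd_of_forty_le h2 hdK hd hS hodd h40
  have hup' : (classNumber K : ℝ) ≤ Real.sqrt d * Real.log d / (Real.pi * η) := by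
    rw [show Real.sqrt d * Real.log d / (Real.pi * η) = 1 / Real.pi * Real.sqrt d * Real.log d / η by
      field_simp]
    exact hup
  exact realZeros_confined_of_classNumber_lt h2 hdK hy8 hprim hquad hodd (lt_of_le_of_lt hup' hη)
    (lt_of_le_of_lt hup' hη')

end RealPointExit

end Literature.NumberTheory.LFunctions

end
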